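import Mathlib
import HarnessLib
import Literature.NumberTheory.DiophantineApproximation.ClassPrimeProductRate

/-!
# TwoTaleP15Saving — the denominator saving of Zudilin's two hypergeometric tales at the point P15 (kernel form)

HONEST FRAMING: systematic search; no irrationality claim unless certified.

fam-denom (pub-zeta5), FAMILY.md §6 D16; serves fam-measure's T3 candidate (`families/measure/FAMILY.md` §2.5).
Zudilin (arXiv:1310.1526, "Two hypergeometric tales and a new irrationality measure of ζ(2)") bounds
`μ(ζ(2)) ≤ 5.09541178…` from the 7-parameter point `(10,10,8,13 | 3,5,24)`. fam-measure's designed point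
**P15**: `a = (13n+1, 11n+1, 9n+1, 15n+1)`, `b = (1, 2n+1, 4n+1, 26n+2)` (slopes `(13,11,9,15 | 0,2,4,26)`, on the
two-tale cone `b₂ = a₄−a₁`, `b₃ = a₄−a₂`, Remark-5 partner `(32; 11,13,15 | 15; 6,24,26)`) has the model value
`μ = 5.04952429…` IF its decay constant, coefficient growth and the "missing brick" inclusion hold (all three checked
numerically by fam-measure / ttrl2 / ref-2, none certified).  This file is the DENOMINATOR side of that claim, proved
unconditionally in the kernel:

* the digit function `φ̃ = max(φ, φ̂)` of Zudilin's Lemma 7 (tale 1, `φ` = the `S₄`-maximum) and Lemma 8 (tale 2, `φ̂`)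
  at P15 is the explicit step function whose super-level sets are the 20 intervals `ivl 0 … ivl 19` below
  (`{φ̃ ≥ 1}` = the 9 intervals `ivl 0..8`, `{φ̃ ≥ 2}` = the 11 intervals `ivl 9..19`; `φ̃ ≤ 2`; `φ̃ = 0` on `[0,1/15)`).
  The TABLE is the definition used here; its identification with Zudilin's `max/min` formulas is an exact finite
  computation recorded in `families/denom/P15KERNEL.md` (`code/denom/p15/digits.py`: S₄-max = Remark-2-min as step
  functions; calibrated on Zudilin's own point, where it reproduces the printed table (P-ar) and the three printed
  savings `8.12793878 / 7.03418177 / 8.79117698`);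
* `savingProduct n = ∏_{i<20} ∏ {p prime : p ≤ 15n, p² > 26n, {n/p} ∈ ivl i}` — the product `Φ̃ₙ = ∏ p^{φ̃(n/p)}` over the
  primes `√(26n) < p ≤ 15n`, typed with the tree's Rhin–Viola class-prime products
  (`Literature.…RhinViola.classPrimeProduct`, one singleton class per interval, so no disjointness bookkeeping);
* **`tendsto_log_savingProduct_div`**: `(1/n) log Φ̃ₙ → savingRate = Σ_{i<20} Σ_{k≥0} (1/(k+uᵢ) − 1/(k+vᵢ))`
  (`= ∫ φ̃ dψ = 15.98087907…`), from the tree's `RhinViola.tendsto_log_classPrimeProduct_div` (Chebyshev/PNT inside);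
* **`tendsto_log_lcmNormaliser_div`**: `(1/n) log (D₁₆ₙ D₁₅ₙ / Φ̃ₙ) → 31 − savingRate` (`D_m = lcm(1..m) = Nat.lcmUpto m`);
* **`savingRate_bounds : 15.98084 ≤ savingRate ≤ 15.98096`** — a certified enclosure by exact partial sums to `K = 10`
  plus the telescoping tail sandwich `(v−u)/(K+m−½+1/(8K)) ≤ Σ_{k≥K} ≤ (v−u)/(K+m−½)`, `m = (u+v)/2`
  (`ivlRate_mem`; per-interval decimals in `P15KERNEL.md`).

Nothing here is an irrationality or measure claim: the measure statement conditional on the three analytic inputs is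
`TwoTaleP15Forms.lean`.  References: W. Zudilin, Ann. Math. Québec 38 (2014) 101–117, arXiv:1310.1526, Lemmas 7–8,
§5 Remark 5; G. Rhin, C. Viola, Acta Arith. 77 (1996) (the `dψ` prime-class rates, tree file
`Literature/NumberTheory/DiophantineApproximation/ClassPrimeProductRate.lean`).
-/

noncomputable section

open Filter Topology Finset
open Literature.NumberTheory.DiophantineApproximation
open Literature.NumberTheory.DiophantineApproximation.RhinViola

namespace Summit.KontsevichZagierPeriods.Zeta5Search.Denom.TwoTaleP15Saving

/-! ### The digit table of `φ̃ = max(φ, φ̂)` at P15 -/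

/-- The 20 intervals `[uᵢ, vᵢ)` of the super-level sets of `φ̃` at P15: `i = 0..8` are the connected components of
`{φ̃ ≥ 1}`, `i = 9..19` those of `{φ̃ ≥ 2} = {φ̃ = 2}`; indices `≥ 20` are junk `(1/2, 1)` (never used). -/
def ivl : ℕ → ℝ × ℝ
  | 0 => (1/15, 1/13) | 1 => (1/11, 4/17) | 2 => (3/11, 2/5) | 3 => (3/7, 8/17) | 4 => (8/15, 7/13)
  | 5 => (6/11, 8/13) | 6 => (7/11, 9/13) | 7 => (5/7, 4/5) | 8 => (9/11, 16/17)
  | 9 => (1/11, 2/17) | 10 => (1/7, 2/13) | 11 => (2/11, 1/5) | 12 => (3/11, 4/13) | 13 => (4/11, 5/13)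
  | 14 => (5/11, 7/15) | 15 => (6/11, 9/16) | 16 => (7/11, 11/17) | 17 => (8/11, 10/13)
  | 18 => (9/11, 14/17) | 19 => (10/11, 14/15) | _ => (1/2, 1)

/-- Every interval of the table satisfies `1/15 ≤ u < v ≤ 1`. -/
theorem ivl_wf (i : ℕ) : 1/15 ≤ (ivl i).1 ∧ (ivl i).1 < (ivl i).2 ∧ (ivl i).2 ≤ 1 := by
  unfold ivl; split <;> norm_num

/-- `0 < uᵢ`. -/
theorem ivl_pos (i : ℕ) : 0 < (ivl i).1 := lt_of_lt_of_le (by norm_num) (ivl_wf i).1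

/-- `uᵢ < vᵢ`. -/
theorem ivl_lt (i : ℕ) : (ivl i).1 < (ivl i).2 := (ivl_wf i).2.1

/-- `vᵢ ≤ 1`. -/
theorem ivl_le_one (i : ℕ) : (ivl i).2 ≤ 1 := (ivl_wf i).2.2

/-- `vᵢ ≤ uᵢ + 1`. -/
theorem ivl_le_add_one (i : ℕ) : (ivl i).2 ≤ (ivl i).1 + 1 := by linarith [ivl_le_one i, ivl_pos i]

/-- The prime cut `p ≤ 15n` (admissible since `φ̃ = 0` on `[0, 1/15)`, i.e. every `uᵢ ≥ 1/15`). -/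
def primeCut (n : ℕ) : ℕ := 15 * n

/-- The cut dominates `n/uᵢ`. -/
theorem div_le_primeCut (i n : ℕ) : (n : ℝ) / (ivl i).1 ≤ (primeCut n : ℝ) := by
  rw [div_le_iff₀ (ivl_pos i), primeCut]
  push_cast
  nlinarith [(ivl_wf i).1, Nat.cast_nonneg (α := ℝ) n]

/-! ### The saving product `Φ̃ₙ` and its rate -/

/-- The class-prime product of ONE interval: `∏ {p prime : p ≤ 15n, 26n < p², uᵢ ≤ {n/p} < vᵢ}`. -/
def ivlProduct (i n : ℕ) : ℕ := classPrimeProduct 26 primeCut {ivl i} n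

/-- **`Φ̃ₙ`** at P15: `∏_{i<20} ivlProduct i n = ∏_{√(26n) < p ≤ 15n} p^{φ̃(n/p)}`. -/
def savingProduct (n : ℕ) : ℕ := ∏ i ∈ range 20, ivlProduct i n

/-- The density term `1/(k+uᵢ) − 1/(k+vᵢ)`. -/
def ivlTerm (i k : ℕ) : ℝ := 1 / ((k : ℝ) + (ivl i).1) - 1 / ((k : ℝ) + (ivl i).2)

/-- The rate of one interval: `Σ_{k≥0} (1/(k+uᵢ) − 1/(k+vᵢ)) = ψ(vᵢ) − ψ(uᵢ) = ∫_{[uᵢ,vᵢ)} dψ`. -/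
def ivlRate (i : ℕ) : ℝ := ∑' k : ℕ, ivlTerm i k

/-- **The saving rate** `∫ φ̃ dψ = Σ_{i<20} ivlRate i` (`= 15.98087907…`, `savingRate_bounds`). -/
def savingRate : ℝ := ∑ i ∈ range 20, ivlRate i

/-- `ivlProduct i n > 0`. -/
theorem ivlProduct_pos (i n : ℕ) : 0 < ivlProduct i n := classPrimeProduct_pos _ _ _ _

/-- `Φ̃ₙ > 0`. -/
theorem savingProduct_pos (n : ℕ) : 0 < savingProduct n := prod_pos fun i _ => ivlProduct_pos i n

/-- Rate of one interval: `(1/n) log ivlProduct i n → ivlRate i` (tree: `RhinViola.tendsto_log_classPrimeProduct_div`). -/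
theorem tendsto_log_ivlProduct_div (i : ℕ) :
    Tendsto (fun n : ℕ => Real.log (ivlProduct i n) / n) atTop (𝓝 (ivlRate i)) := by
  have h := tendsto_log_classPrimeProduct_div (C := 26) (by norm_num) primeCut {ivl i}
    (fun I hI => by rw [mem_singleton] at hI; subst hI; exact ⟨ivl_pos i, ivl_lt i, ivl_le_one i⟩)
    (fun I hI n => by rw [mem_singleton] at hI; subst hI; exact div_le_primeCut i n)
    (fun I hI I' hI' hne => by
      rw [mem_singleton] at hI hI'; exact absurd (hI.trans hI'.symm) hne)
  simpa only [sum_singleton, ivlProduct, ivlRate, ivlTerm] using h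

/-- **Rate of `Φ̃ₙ`**: `(1/n) log Φ̃ₙ → savingRate = ∫ φ̃ dψ`. -/
theorem tendsto_log_savingProduct_div :
    Tendsto (fun n : ℕ => Real.log (savingProduct n) / n) atTop (𝓝 savingRate) := by
  have h := tendsto_finsetSum (range 20) fun i (_ : i ∈ range 20) => tendsto_log_ivlProduct_div i
  refine h.congr fun n => ?_
  have hne : ∀ i ∈ range 20, ((ivlProduct i n : ℕ) : ℝ) ≠ 0 := fun i _ => by
    exact_mod_cast (ivlProduct_pos i n).ne'
  rw [savingProduct, Nat.cast_prod, Real.log_prod hne, sum_div]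

/-- **Rate of the normaliser `D₁₆ₙ D₁₅ₙ / Φ̃ₙ`**: `(1/n) log (D₁₆ₙ D₁₅ₙ / Φ̃ₙ) → 31 − savingRate`
(prime number theorem for `D_m = lcm(1..m)`, tree: `ViolaZudilin.tendsto_log_lcmUpto_mul_lcmUpto_div`). -/
theorem tendsto_log_lcmNormaliser_div :
    Tendsto (fun n : ℕ => Real.log (((Nat.lcmUpto (16 * n) : ℝ) * Nat.lcmUpto (15 * n)) /
        savingProduct n) / n) atTop (𝓝 (31 - savingRate)) := by
  have h1 := ViolaZudilin.tendsto_log_lcmUpto_mul_lcmUpto_div (a := 16) (b := 15) (by norm_num) (by norm_num)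
  have h2 := tendsto_log_savingProduct_div
  have e : ((16 : ℕ) : ℝ) + (15 : ℕ) - savingRate = 31 - savingRate := by norm_num
  rw [← e]
  refine (h1.sub h2).congr fun n => ?_
  have hd : ((Nat.lcmUpto (16 * n) : ℝ) * Nat.lcmUpto (15 * n)) ≠ 0 := by
    have := Nat.lcmUpto_pos (16 * n)
    have := Nat.lcmUpto_pos (15 * n)
    positivity
  have hΦ : (savingProduct n : ℝ) ≠ 0 := by exact_mod_cast (savingProduct_pos n).ne'
  rw [Real.log_div hd hΦ, sub_div]

/-! ### Certified enclosure of the saving rate -/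

/-- The telescoping series `Σ_{k≥0} (1/(k+a) − 1/(k+a+1)) = 1/a` (`a > 0`). -/
theorem hasSum_shiftedTelescope {a : ℝ} (ha : 0 < a) :
    HasSum (fun k : ℕ => 1 / ((k : ℝ) + a) - 1 / ((k : ℝ) + a + 1)) (1 / a) := by
  have hnn : ∀ k : ℕ, 0 ≤ 1 / ((k : ℝ) + a) - 1 / ((k : ℝ) + a + 1) := fun k =>
    sub_nonneg.2 (one_div_le_one_div_of_le (by positivity) (by linarith))
  rw [hasSum_iff_tendsto_nat_of_nonneg hnn]
  have hps : ∀ n : ℕ, ∑ k ∈ range n, (1 / ((k : ℝ) + a) - 1 / ((k : ℝ) + a + 1)) = 1 / a - 1 / ((n : ℝ) + a) := by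
    intro n
    induction n with
    | zero => simp
    | succ n ih =>
      rw [sum_range_succ, ih]
      push_cast
      ring
  simp_rw [hps]
  have ht : Tendsto (fun n : ℕ => (n : ℝ) + a) atTop atTop :=
    tendsto_atTop_add_const_right _ _ tendsto_natCast_atTop_atTop
  simpa using (tendsto_const_nhds (x := 1 / a)).sub (ht.inv_tendsto_atTop.congr fun n => (one_div _).symm)

/-- Summability of the density terms of an interval (tree: `RhinViola.summable_densityTerm`). -/
theorem summable_ivlTerm (i : ℕ) : Summable (ivlTerm i) :=
  summable_densityTerm (ivl_pos i) (ivl_lt i).le (ivl_le_add_one i)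

/-- **Tail sandwich.** For `K ≥ 1`, `m = (u+v)/2`:
`(v−u)/(K+m−½+1/(8K)) ≤ Σ_{k≥K} (1/(k+u) − 1/(k+v)) ≤ (v−u)/(K+m−½)`
(termwise comparison with telescoping series: `(k+u)(k+v) = (k+m)² − w²`, `w = (v−u)/2 ≤ ½`). -/
theorem ivlTerm_tail_sandwich (i K : ℕ) (hK : 0 < K) :
    ((ivl i).2 - (ivl i).1) * (1 / ((K : ℝ) + ((ivl i).1 + (ivl i).2) / 2 - 1 / 2 + 1 / (8 * K))) ≤
        ∑' k : ℕ, ivlTerm i (k + K) ∧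
      ∑' k : ℕ, ivlTerm i (k + K) ≤ ((ivl i).2 - (ivl i).1) * (1 / ((K : ℝ) + ((ivl i).1 + (ivl i).2) / 2 - 1 / 2)) := by
  set u := (ivl i).1 with hu
  set v := (ivl i).2 with hv
  have hu0 : 0 < u := ivl_pos i
  have huv : u < v := ivl_lt i
  have hv1 : v ≤ u + 1 := ivl_le_add_one i
  have hv0 : 0 < v := hu0.trans huv
  have hvu0 : 0 < v - u := sub_pos.2 huv
  have hw : (v - u) * (v - u) ≤ 1 := by nlinarith
  have hK1 : (1 : ℝ) ≤ K := by exact_mod_cast hK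
  have hf : HasSum (fun k : ℕ => ivlTerm i (k + K)) (∑' k : ℕ, ivlTerm i (k + K)) :=
    ((summable_nat_add_iff K).2 (summable_ivlTerm i)).hasSum
  -- the two comparison parameters
  set s : ℝ := 1 / (8 * K) with hs
  have hs0 : 0 < s := by positivity
  have hsK : s * K = 1 / 8 := by rw [hs]; field_simp
  set a : ℝ := (K : ℝ) + (u + v) / 2 - 1 / 2 + s with ha
  set b : ℝ := (K : ℝ) + (u + v) / 2 - 1 / 2 with hb
  have ha0 : 0 < a := by rw [ha]; linarith
  have hb0 : 0 < b := by rw [hb]; linarith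
  have hga := (hasSum_shiftedTelescope ha0).mul_left (v - u)
  have hgb := (hasSum_shiftedTelescope hb0).mul_left (v - u)
  have hterm : ∀ k : ℕ, ivlTerm i (k + K) = (v - u) / ((((k + K : ℕ) : ℝ) + u) * (((k + K : ℕ) : ℝ) + v)) := by
    intro k
    have h1 : (((k + K : ℕ) : ℝ) + u) ≠ 0 := by positivity
    have h2 : (((k + K : ℕ) : ℝ) + v) ≠ 0 := by positivity
    rw [ivlTerm, ← hu, ← hv, div_sub_div _ _ h1 h2, one_mul, mul_one]
    ring_nf
  have htel : ∀ (c : ℝ) (k : ℕ), 0 < c →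
      1 / ((k : ℝ) + c) - 1 / ((k : ℝ) + c + 1) = 1 / (((k : ℝ) + c) * ((k : ℝ) + c + 1)) := by
    intro c k hc
    have h1 : (k : ℝ) + c ≠ 0 := by positivity
    have h2 : (k : ℝ) + c + 1 ≠ 0 := by positivity
    rw [div_sub_div _ _ h1 h2, one_mul, mul_one]
    ring_nf
  constructor
  · refine hasSum_le (fun k => ?_) hga hf
    rw [hterm, htel a k ha0, div_eq_mul_one_div (v - u)]
    refine mul_le_mul_of_nonneg_left (one_div_le_one_div_of_le (by positivity) ?_) (by linarith)
    have hX : (K : ℝ) ≤ ((k + K : ℕ) : ℝ) := by push_cast; linarith [Nat.cast_nonneg (α := ℝ) k]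
    have hsX : s * K ≤ s * ((k + K : ℕ) : ℝ) := mul_le_mul_of_nonneg_left hX hs0.le
    rw [ha]
    push_cast at hX hsX ⊢
    nlinarith [sq_nonneg (v - u), mul_nonneg hs0.le hu0.le, mul_nonneg hs0.le hv0.le, sq_nonneg s, hsX, hsK]
  · refine hasSum_le (fun k => ?_) hf hgb
    rw [hterm, htel b k hb0, div_eq_mul_one_div (v - u)]
    refine mul_le_mul_of_nonneg_left (one_div_le_one_div_of_le (by positivity) ?_) (by linarith)
    rw [hb]
    push_cast
    nlinarith [hw, hvu0, Nat.cast_nonneg (α := ℝ) k]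

/-- **Enclosure of one interval's rate** from the exact partial sum to `K` and the tail sandwich. -/
theorem ivlRate_mem {i K : ℕ} (hK : 0 < K) {lo hi : ℝ}
    (hlo : lo ≤ ∑ k ∈ range K, ivlTerm i k +
      ((ivl i).2 - (ivl i).1) * (1 / ((K : ℝ) + ((ivl i).1 + (ivl i).2) / 2 - 1 / 2 + 1 / (8 * K))))
    (hhi : ∑ k ∈ range K, ivlTerm i k +
      ((ivl i).2 - (ivl i).1) * (1 / ((K : ℝ) + ((ivl i).1 + (ivl i).2) / 2 - 1 / 2)) ≤ hi) :
    lo ≤ ivlRate i ∧ ivlRate i ≤ hi := by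
  have hsplit : ∑ k ∈ range K, ivlTerm i k + ∑' k : ℕ, ivlTerm i (k + K) = ivlRate i :=
    (summable_ivlTerm i).sum_add_tsum_nat_add K
  have ht := ivlTerm_tail_sandwich i K hK
  constructor <;> linarith [ht.1, ht.2]

/-- **Certified enclosure `15.98084 ≤ ∫ φ̃ dψ ≤ 15.98096`** (`K = 10` partial sums per interval; the model value is
`15.98087907…`). -/
theorem savingRate_bounds : (15.98084 : ℝ) ≤ savingRate ∧ savingRate ≤ 15.98096 := by
  have h0 := ivlRate_mem (i := 0) (K := 10) (by norm_num) (lo := 2.0152578) (hi := 2.0152593)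
    (by norm_num [ivl, ivlTerm, sum_range_succ, sum_range_zero])
    (by norm_num [ivl, ivlTerm, sum_range_succ, sum_range_zero])
  have h1 := ivlRate_mem (i := 1) (K := 10) (by norm_num) (lo := 6.9416497) (hi := 6.9416691)
    (by norm_num [ivl, ivlTerm, sum_range_succ, sum_range_zero])
    (by norm_num [ivl, ivlTerm, sum_range_succ, sum_range_zero])
  have h2 := ivlRate_mem (i := 2) (K := 10) (by norm_num) (lo := 1.3058556) (hi := 1.3058722)
    (by norm_num [ivl, ivlTerm, sum_range_succ, sum_range_zero])
    (by norm_num [ivl, ivlTerm, sum_range_succ, sum_range_zero])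
  have h3 := ivlRate_mem (i := 3) (K := 10) (by norm_num) (lo := 0.2494482) (hi := 0.2494536)
    (by norm_num [ivl, ivlTerm, sum_range_succ, sum_range_zero])
    (by norm_num [ivl, ivlTerm, sum_range_succ, sum_range_zero])
  have h4 := ivlRate_mem (i := 4) (K := 10) (by norm_num) (lo := 0.0225027) (hi := 0.0225034)
    (by norm_num [ivl, ivlTerm, sum_range_succ, sum_range_zero])
    (by norm_num [ivl, ivlTerm, sum_range_succ, sum_range_zero])
  have h5 := ivlRate_mem (i := 5) (K := 10) (by norm_num) (lo := 0.2693556) (hi := 0.2693643)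
    (by norm_num [ivl, ivlTerm, sum_range_succ, sum_range_zero])
    (by norm_num [ivl, ivlTerm, sum_range_succ, sum_range_zero])
  have h6 := ivlRate_mem (i := 6) (K := 10) (by norm_num) (lo := 0.1726032) (hi := 0.17261)
    (by norm_num [ivl, ivlTerm, sum_range_succ, sum_range_zero])
    (by norm_num [ivl, ivlTerm, sum_range_succ, sum_range_zero])
  have h7 := ivlRate_mem (i := 7) (K := 10) (by norm_num) (lo := 0.2151692) (hi := 0.2151795)
    (by norm_num [ivl, ivlTerm, sum_range_succ, sum_range_zero])
    (by norm_num [ivl, ivlTerm, sum_range_succ, sum_range_zero])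
  have h8 := ivlRate_mem (i := 8) (K := 10) (by norm_num) (lo := 0.2455425) (hi := 0.2455568)
    (by norm_num [ivl, ivlTerm, sum_range_succ, sum_range_zero])
    (by norm_num [ivl, ivlTerm, sum_range_succ, sum_range_zero])
  have h9 := ivlRate_mem (i := 9) (K := 10) (by norm_num) (lo := 2.5381141) (hi := 2.5381178)
    (by norm_num [ivl, ivlTerm, sum_range_succ, sum_range_zero])
    (by norm_num [ivl, ivlTerm, sum_range_succ, sum_range_zero])
  have h10 := ivlRate_mem (i := 10) (K := 10) (by norm_num) (lo := 0.5148161) (hi := 0.5148177)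
    (by norm_num [ivl, ivlTerm, sum_range_succ, sum_range_zero])
    (by norm_num [ivl, ivlTerm, sum_range_succ, sum_range_zero])
  have h11 := ivlRate_mem (i := 11) (K := 10) (by norm_num) (lo := 0.52329) (hi := 0.5232925)
    (by norm_num [ivl, ivlTerm, sum_range_succ, sum_range_zero])
    (by norm_num [ivl, ivlTerm, sum_range_succ, sum_range_zero])
  have h12 := ivlRate_mem (i := 12) (K := 10) (by norm_num) (lo := 0.4567431) (hi := 0.4567477)
    (by norm_num [ivl, ivlTerm, sum_range_succ, sum_range_zero])
    (by norm_num [ivl, ivlTerm, sum_range_succ, sum_range_zero])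
  have h13 := ivlRate_mem (i := 13) (K := 10) (by norm_num) (lo := 0.1720608) (hi := 0.1720636)
    (by norm_num [ivl, ivlTerm, sum_range_succ, sum_range_zero])
    (by norm_num [ivl, ivlTerm, sum_range_succ, sum_range_zero])
  have h14 := ivlRate_mem (i := 14) (K := 10) (by norm_num) (lo := 0.0688828) (hi := 0.0688844)
    (by norm_num [ivl, ivlTerm, sum_range_succ, sum_range_zero])
    (by norm_num [ivl, ivlTerm, sum_range_succ, sum_range_zero])
  have h15 := ivlRate_mem (i := 15) (K := 10) (by norm_num) (lo := 0.0707601) (hi := 0.0707623)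
    (by norm_num [ivl, ivlTerm, sum_range_succ, sum_range_zero])
    (by norm_num [ivl, ivlTerm, sum_range_succ, sum_range_zero])
  have h16 := ivlRate_mem (i := 16) (K := 10) (by norm_num) (lo := 0.0348508) (hi := 0.0348522)
    (by norm_num [ivl, ivlTerm, sum_range_succ, sum_range_zero])
    (by norm_num [ivl, ivlTerm, sum_range_succ, sum_range_zero])
  have h17 := ivlRate_mem (i := 17) (K := 10) (by norm_num) (lo := 0.1071022) (hi := 0.1071072)
    (by norm_num [ivl, ivlTerm, sum_range_succ, sum_range_zero])
    (by norm_num [ivl, ivlTerm, sum_range_succ, sum_range_zero])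
  have h18 := ivlRate_mem (i := 18) (K := 10) (by norm_num) (lo := 0.0118197) (hi := 0.0118204)
    (by norm_num [ivl, ivlTerm, sum_range_succ, sum_range_zero])
    (by norm_num [ivl, ivlTerm, sum_range_succ, sum_range_zero])
  have h19 := ivlRate_mem (i := 19) (K := 10) (by norm_num) (lo := 0.0450163) (hi := 0.0450192)
    (by norm_num [ivl, ivlTerm, sum_range_succ, sum_range_zero])
    (by norm_num [ivl, ivlTerm, sum_range_succ, sum_range_zero])
  simp only [savingRate, sum_range_succ, sum_range_zero, zero_add]
  constructor
  · linarith [h0.1, h1.1, h2.1, h3.1, h4.1, h5.1, h6.1, h7.1, h8.1, h9.1, h10.1, h11.1, h12.1, h13.1, h14.1,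
      h15.1, h16.1, h17.1, h18.1, h19.1]
  · linarith [h0.2, h1.2, h2.2, h3.2, h4.2, h5.2, h6.2, h7.2, h8.2, h9.2, h10.2, h11.2, h12.2, h13.2, h14.2,
      h15.2, h16.2, h17.2, h18.2, h19.2]

/-- `savingRate < 31 = 16 + 15`: the saving is a proper part of the normaliser `D₁₆ₙ D₁₅ₙ`. -/
theorem savingRate_lt : savingRate < 31 := by linarith [savingRate_bounds.2]

end Summit.KontsevichZagierPeriods.Zeta5Search.Denom.TwoTaleP15Saving

end
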